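import Literature.NumberTheory.Automorphic.StableCentralizerEquivCM          -- ★ `archStableCentralizerEquiv`, `coe_archStableCentralizerEquiv_eq_of_conj_eq`
import Literature.NumberTheory.Automorphic.ArchCongruenceOrbitalTransport     -- ★ (T-d) FILE 1: `forall_archCongr_mem_centralizer_iff`, `coe_archCongrOfEq_apply`
import Literature.NumberTheory.Rogawski1990.ArchInnerTransferCongruence     -- ★ (T-d) FILE 2: `corresponds_archCongr_left_iff`, `…_right_iff`, `isRegularElt_coe_archCongr_iff`
import HarnessLib

/-!
# The stable centraliser equivalence `Z(γ) ≃ₜ* Z(γ′)` is natural under the congruence `g ↦ (P ⊗ 1) g (P ⊗ 1)⁻¹` of the archimedean unitary groups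
(ROAD-Sd, LEDGER v2 R5 `stub_TdAssembly`'s one missing lemma «(C′)(C′G) naturality of `archStableCentralizerEquiv` under `P ⊗ 1`»; Rogawski 1990 §4.3 pp. 43–44, §14.1 p. 232)

Topic `NumberTheory/Rogawski1990`; namespace `Literature.NumberTheory.Automorphic.UnitaryGroup` (the namespace of ★ `archStableCentralizerEquiv`).  THEOREMS ONLY (no `def`, no
instance, no notation, no axiom, no named fact, no `sorry`).  Cell `pub/hodgecm-mathlib`, ENGINE T1 (crux H413 = `stmt-HodgeConjecture-24833`); floor-1, count-neutral; LEAD WORD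
T8-68 (a) (F0P3a-plan (g9)); census `CENSUS-R5a-StableCentralizerEquivNaturality` 20b2040b; author F0P3a-p03 (g10); consumer = the R5 «(T-d) ASSEMBLY» of F0P3a-p02 (LEDGER
`ROAD-Sd v2` §4 R5).

THE STATEMENT.  The 13-conjunct system ★ #77 `ArchTransfersExistCanonical` carries torus data `t′, t` on the archimedean groups `G′_∞ = U(H′)(L ⊗ ℝ)`, `G_∞ = U(Φ₃)(L ⊗ ℝ)`
with the coherence conjuncts (C′)(C)(C′G): for corresponding regular pairs the CANONICAL isomorphism of centralisers ★ `archStableCentralizerEquiv` («`Z(γ₁) ≃ₜ* Z(γ₂)`,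
conjugation by ANY conjugator», [Rogawski1990 §4.3 pp. 43–44]) carries `t_{γ₁}` to `t_{γ₂}`.  R5 transports the whole system along a congruence `Φ : U(H₂)(L ⊗ ℝ) ≃ₜ* U(H)(L ⊗ ℝ)`,
`Φ g = T g T⁻¹`, `T = P ⊗ 1` (the ABSTRACT frame `(T, Φ, hΦ)` of ★ (T-d) FILES 1–4), replacing `t′` by its pull-back `t₂ γ := (Φ|_{Z(γ)})⁻¹_* t′(Φ γ)`; to re-establish (C′)(C)(C′G)
for the transported data one needs exactly that `archStableCentralizerEquiv` COMMUTES WITH THE RESTRICTIONS `Φ|_Z`: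
* (N-L) LEFT (source moved, target fixed — the (C′G) shape): `SCE(Φ γ, a) ∘ Φ|_{Z(γ)} = SCE(γ, a)`;
* (N-R) RIGHT (target moved — for carrying the `Φ₃` side to a diagonal form): `SCE(a, Φ γ) = Φ|_{Z(γ)} ∘ SCE(a, γ)`;
* (N-B) BOTH (one group moved — the (C′)∕(C) shape): `SCE(Φ γ₁, Φ γ₂) ∘ Φ|_{Z(γ₁)} = Φ|_{Z(γ₂)} ∘ SCE(γ₁, γ₂)`;
each as the identity of `GL_N(L ⊗ ℝ)`-values, as an identity of elements of the target centraliser, and as the `Measure.map` identity in the exact (C′)∕(C′G) shapes (torus measures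
pushed along `subgroupCongrHomeomorph Φ.toMulEquiv Z(γ) Z(Φ γ) (forall_archCongr_mem_centralizer_iff L Φ rfl) Φ.continuous Φ.symm.continuous`, ★ (T-d) FILE 1's token).  PROOF: ★
`coe_archStableCentralizerEquiv_eq_of_conj_eq` (the equivalence is conjugation by any conjugator `y`) with `y` on one side and `y·T` ∕ `T⁻¹·y` ∕ `T⁻¹·y·T` on the other (★ `Corresponds.conjugator_spec`,
`hΦ`); then `Measure.map_map`.  The inner-automorphism case `Φ = conj q` is ★ `map_subgroupCongrHomeomorph_conj_eq_map_archStableCentralizerEquiv`.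
HONEST LABEL: HC_CM is proved only modulo the printed citations until rung 0 closes; this file is in-house algebra of conjugators and pays nothing by itself.

## References
* [Rogawski1990] J. D. Rogawski, *Automorphic Representations of Unitary Groups in Three Variables*, Ann. of Math. Stud. 123 (1990), §4.3 pp. 43–44 (orbital integrals with compatible
  measures; the centraliser identification is canonical up to stable conjugacy), §14.1 p. 232 (inner forms and the congruence of hermitian forms).
* [PlatonovRapinchuk1994] V. Platonov, A. Rapinchuk, *Algebraic Groups and Number Theory* (1994), §2.3 (unitary groups of congruent forms are conjugate inside `GL_N`).
-/

set_option autoImplicit false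

noncomputable section

open MeasureTheory Measure NumberField NumberField.InfinitePlace
open Literature.MeasureTheory.Group Literature.NumberTheory.Rogawski1990
open scoped Matrix MatrixGroups

namespace Literature.NumberTheory.Automorphic

namespace UnitaryGroup

section Naturality

variable (L : Type) [Field L] [NumberField L] [IsCMField L] {N : ℕ} {H H₂ X : Matrix (Fin N) (Fin N) L}
  (hH : H.det ≠ 0) (hH₂ : H₂.det ≠ 0) (hX : X.det ≠ 0) (T : GL (Fin N) (mixedEmbedding.mixedSpace L))
  (Φ : arch (↥(maximalRealSubfield L)) L (IsCMField.complexConj L) N H₂ ≃ₜ* arch (↥(maximalRealSubfield L)) L (IsCMField.complexConj L) N H)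
  (hΦ : ∀ g : arch (↥(maximalRealSubfield L)) L (IsCMField.complexConj L) N H₂,
    ((Φ g : arch (↥(maximalRealSubfield L)) L (IsCMField.complexConj L) N H) : GL (Fin N) (mixedEmbedding.mixedSpace L)) =
      T * (g : GL (Fin N) (mixedEmbedding.mixedSpace L)) * T⁻¹)

/-! ### (N-L) LEFT: the source is moved by `Φ`, the target is fixed (the (C′G) shape) -/

include hΦ in
/-- **(N-L), values**: for `γ ∈ U(H₂)`, `a ∈ U(X)`, `Φ γ ↔ a` regular and `z ∈ Z(γ)`: `SCE(Φ γ, a)(Φ z) = SCE(γ, a)(z)` in `GL_N(L ⊗ ℝ)` — both are `y·T·z·T⁻¹·y⁻¹` for a conjugator `y` of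
`Φ γ` to `a` (`y·T` conjugates `γ` to `a`). [cite: Rogawski1990, §4.3 pp. 43–44; §14.1 p. 232] [cite: PlatonovRapinchuk1994, §2.3] -/
theorem coe_archStableCentralizerEquiv_archCongr_left {γ : arch (↥(maximalRealSubfield L)) L (IsCMField.complexConj L) N H₂}
    {a : arch (↥(maximalRealSubfield L)) L (IsCMField.complexConj L) N X}
    (hc : Corresponds (conjMixed (↥(maximalRealSubfield L)) L (IsCMField.complexConj L)) (archFormOf L N H) (archFormOf L N X) (Φ γ) a)
    (h : IsRegularElt ((Φ γ).val : GL (Fin N) (mixedEmbedding.mixedSpace L)))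
    (z : Subgroup.centralizer ({γ} : Set (arch (↥(maximalRealSubfield L)) L (IsCMField.complexConj L) N H₂))) :
    (((archStableCentralizerEquiv L hH hX hc h ⟨Φ z, (forall_archCongr_mem_centralizer_iff L Φ rfl z).2 z.2⟩ :
        Subgroup.centralizer ({a} : Set (arch (↥(maximalRealSubfield L)) L (IsCMField.complexConj L) N X))) :
          arch (↥(maximalRealSubfield L)) L (IsCMField.complexConj L) N X).val : GL (Fin N) (mixedEmbedding.mixedSpace L)) =
      (((archStableCentralizerEquiv L hH₂ hX ((corresponds_archCongr_left_iff L T Φ hΦ γ a).1 hc) ((isRegularElt_coe_archCongr_iff L T Φ hΦ γ).1 h) z :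
        Subgroup.centralizer ({a} : Set (arch (↥(maximalRealSubfield L)) L (IsCMField.complexConj L) N X))) :
          arch (↥(maximalRealSubfield L)) L (IsCMField.complexConj L) N X).val : GL (Fin N) (mixedEmbedding.mixedSpace L)) := by
  have hy : hc.conjugator * ((Φ γ).val : GL (Fin N) (mixedEmbedding.mixedSpace L)) * hc.conjugator⁻¹ = a.val := hc.conjugator_spec
  have hy' : hc.conjugator * T * (γ.val : GL (Fin N) (mixedEmbedding.mixedSpace L)) * (hc.conjugator * T)⁻¹ = a.val := by
    rw [← hy, hΦ γ, mul_inv_rev]; group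
  rw [coe_archStableCentralizerEquiv_eq_of_conj_eq L hH hX hc h hc.conjugator hy,
    coe_archStableCentralizerEquiv_eq_of_conj_eq L hH₂ hX _ _ (hc.conjugator * T) hy' z]
  change hc.conjugator * ((Φ (z : arch (↥(maximalRealSubfield L)) L (IsCMField.complexConj L) N H₂) : arch (↥(maximalRealSubfield L)) L
      (IsCMField.complexConj L) N H) : GL (Fin N) (mixedEmbedding.mixedSpace L)) * hc.conjugator⁻¹ = _
  rw [hΦ, mul_inv_rev]; group

include hΦ in
/-- **(N-L), elements**: `SCE(Φ γ, a) ⟨Φ z, _⟩ = SCE(γ, a) z` in `Z(a)`. [cite: Rogawski1990, §4.3 pp. 43–44; §14.1 p. 232] -/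
theorem archStableCentralizerEquiv_archCongr_left_apply {γ : arch (↥(maximalRealSubfield L)) L (IsCMField.complexConj L) N H₂}
    {a : arch (↥(maximalRealSubfield L)) L (IsCMField.complexConj L) N X}
    (hc : Corresponds (conjMixed (↥(maximalRealSubfield L)) L (IsCMField.complexConj L)) (archFormOf L N H) (archFormOf L N X) (Φ γ) a)
    (h : IsRegularElt ((Φ γ).val : GL (Fin N) (mixedEmbedding.mixedSpace L)))
    (z : Subgroup.centralizer ({γ} : Set (arch (↥(maximalRealSubfield L)) L (IsCMField.complexConj L) N H₂))) :
    archStableCentralizerEquiv L hH hX hc h ⟨Φ z, (forall_archCongr_mem_centralizer_iff L Φ rfl z).2 z.2⟩ =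
      archStableCentralizerEquiv L hH₂ hX ((corresponds_archCongr_left_iff L T Φ hΦ γ a).1 hc) ((isRegularElt_coe_archCongr_iff L T Φ hΦ γ).1 h) z :=
  Subtype.ext (Subtype.ext (coe_archStableCentralizerEquiv_archCongr_left L hH hH₂ hX T Φ hΦ hc h z))

include hΦ in
/-- **(N-L), measures — the (C′G) shape under transport**: for a measure `μ` on `Z(γ) ≤ U(H₂)` pushed to `Z(Φ γ)` along `Φ|_Z` (★ (T-d) FILE 1's token `subgroupCongrHomeomorph Φ.toMulEquiv …`):
`SCE(Φ γ, a)_* ((Φ|_Z)_* μ) = SCE(γ, a)_* μ`.  So (C′G) for `t′` at `(Φ γ, a)` with `t′(Φ γ) = (Φ|_Z)_* t₂ γ` IS (C′G) for the transported `t₂` at `(γ, a)`.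
[cite: Rogawski1990, §4.3 pp. 43–44; §14.1 p. 232] [cite: DeitmarEchterhoff2014, Thm. 1.5.3] -/
theorem map_archStableCentralizerEquiv_map_subgroupCongrHomeomorph_archCongr_left
    [MeasurableSpace (arch (↥(maximalRealSubfield L)) L (IsCMField.complexConj L) N H₂)] [BorelSpace (arch (↥(maximalRealSubfield L)) L (IsCMField.complexConj L) N H₂)]
    [MeasurableSpace (arch (↥(maximalRealSubfield L)) L (IsCMField.complexConj L) N H)] [BorelSpace (arch (↥(maximalRealSubfield L)) L (IsCMField.complexConj L) N H)]
    [MeasurableSpace (arch (↥(maximalRealSubfield L)) L (IsCMField.complexConj L) N X)] [BorelSpace (arch (↥(maximalRealSubfield L)) L (IsCMField.complexConj L) N X)]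
    {γ : arch (↥(maximalRealSubfield L)) L (IsCMField.complexConj L) N H₂} {a : arch (↥(maximalRealSubfield L)) L (IsCMField.complexConj L) N X}
    (hc : Corresponds (conjMixed (↥(maximalRealSubfield L)) L (IsCMField.complexConj L)) (archFormOf L N H) (archFormOf L N X) (Φ γ) a)
    (h : IsRegularElt ((Φ γ).val : GL (Fin N) (mixedEmbedding.mixedSpace L)))
    (μ : Measure (Subgroup.centralizer ({γ} : Set (arch (↥(maximalRealSubfield L)) L (IsCMField.complexConj L) N H₂)))) :
    Measure.map (archStableCentralizerEquiv L hH hX hc h)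
        (Measure.map (subgroupCongrHomeomorph Φ.toMulEquiv (Subgroup.centralizer ({γ} : Set _)) (Subgroup.centralizer ({Φ γ} : Set _))
          (forall_archCongr_mem_centralizer_iff L Φ rfl) Φ.continuous Φ.symm.continuous) μ) =
      Measure.map (archStableCentralizerEquiv L hH₂ hX ((corresponds_archCongr_left_iff L T Φ hΦ γ a).1 hc) ((isRegularElt_coe_archCongr_iff L T Φ hΦ γ).1 h)) μ := by
  rw [Measure.map_map (map_continuous (archStableCentralizerEquiv L hH hX hc h)).measurable (Homeomorph.continuous _).measurable]
  congr 1
  funext z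
  exact archStableCentralizerEquiv_archCongr_left_apply L hH hH₂ hX T Φ hΦ hc h z

/-! ### (N-R) RIGHT: the target is moved by `Φ`, the source is fixed -/

include hΦ in
/-- **(N-R), values**: for `a ∈ U(X)`, `γ ∈ U(H₂)`, `a ↔ Φ γ`, `a` regular, `z ∈ Z(a)`: `SCE(a, Φ γ)(z) = Φ (SCE(a, γ)(z))` in `GL_N(L ⊗ ℝ)` (`T·y` conjugates `a` to `Φ γ` when `y` conjugates `a` to `γ`).
[cite: Rogawski1990, §4.3 pp. 43–44; §14.1 p. 232] [cite: PlatonovRapinchuk1994, §2.3] -/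
theorem coe_archStableCentralizerEquiv_archCongr_right {a : arch (↥(maximalRealSubfield L)) L (IsCMField.complexConj L) N X}
    {γ : arch (↥(maximalRealSubfield L)) L (IsCMField.complexConj L) N H₂}
    (hc : Corresponds (conjMixed (↥(maximalRealSubfield L)) L (IsCMField.complexConj L)) (archFormOf L N X) (archFormOf L N H) a (Φ γ))
    (h : IsRegularElt (a.val : GL (Fin N) (mixedEmbedding.mixedSpace L)))
    (z : Subgroup.centralizer ({a} : Set (arch (↥(maximalRealSubfield L)) L (IsCMField.complexConj L) N X))) :
    (((archStableCentralizerEquiv L hX hH hc h z :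
        Subgroup.centralizer ({Φ γ} : Set (arch (↥(maximalRealSubfield L)) L (IsCMField.complexConj L) N H))) :
          arch (↥(maximalRealSubfield L)) L (IsCMField.complexConj L) N H).val : GL (Fin N) (mixedEmbedding.mixedSpace L)) =
      ((Φ ((archStableCentralizerEquiv L hX hH₂ ((corresponds_archCongr_right_iff L T Φ hΦ a γ).1 hc) h z :
        Subgroup.centralizer ({γ} : Set (arch (↥(maximalRealSubfield L)) L (IsCMField.complexConj L) N H₂))) :
          arch (↥(maximalRealSubfield L)) L (IsCMField.complexConj L) N H₂) : arch (↥(maximalRealSubfield L)) L (IsCMField.complexConj L) N H).val :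
            GL (Fin N) (mixedEmbedding.mixedSpace L)) := by
  have hc₂ := (corresponds_archCongr_right_iff L T Φ hΦ a γ).1 hc
  have hy : hc₂.conjugator * (a.val : GL (Fin N) (mixedEmbedding.mixedSpace L)) * hc₂.conjugator⁻¹ = γ.val := hc₂.conjugator_spec
  have hy' : T * hc₂.conjugator * (a.val : GL (Fin N) (mixedEmbedding.mixedSpace L)) * (T * hc₂.conjugator)⁻¹ = (Φ γ).val := by
    rw [show ((Φ γ).val : GL (Fin N) (mixedEmbedding.mixedSpace L)) = T * (γ : GL (Fin N) (mixedEmbedding.mixedSpace L)) * T⁻¹ from hΦ γ, ← hy, mul_inv_rev]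
    group
  rw [coe_archStableCentralizerEquiv_eq_of_conj_eq L hX hH hc h (T * hc₂.conjugator) hy' z,
    show ((Φ ((archStableCentralizerEquiv L hX hH₂ hc₂ h z : Subgroup.centralizer ({γ} : Set _)) : arch (↥(maximalRealSubfield L)) L
      (IsCMField.complexConj L) N H₂) : arch (↥(maximalRealSubfield L)) L (IsCMField.complexConj L) N H).val : GL (Fin N) (mixedEmbedding.mixedSpace L)) =
        T * (((archStableCentralizerEquiv L hX hH₂ hc₂ h z : Subgroup.centralizer ({γ} : Set _)) : arch (↥(maximalRealSubfield L)) L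
          (IsCMField.complexConj L) N H₂).val : GL (Fin N) (mixedEmbedding.mixedSpace L)) * T⁻¹ from hΦ _,
    coe_archStableCentralizerEquiv_eq_of_conj_eq L hX hH₂ hc₂ h hc₂.conjugator hy z, mul_inv_rev]
  group

include hΦ in
/-- **(N-R), elements**: `SCE(a, Φ γ) z = ⟨Φ (SCE(a, γ) z), _⟩` in `Z(Φ γ)`. [cite: Rogawski1990, §4.3 pp. 43–44; §14.1 p. 232] -/
theorem archStableCentralizerEquiv_archCongr_right_apply {a : arch (↥(maximalRealSubfield L)) L (IsCMField.complexConj L) N X}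
    {γ : arch (↥(maximalRealSubfield L)) L (IsCMField.complexConj L) N H₂}
    (hc : Corresponds (conjMixed (↥(maximalRealSubfield L)) L (IsCMField.complexConj L)) (archFormOf L N X) (archFormOf L N H) a (Φ γ))
    (h : IsRegularElt (a.val : GL (Fin N) (mixedEmbedding.mixedSpace L)))
    (z : Subgroup.centralizer ({a} : Set (arch (↥(maximalRealSubfield L)) L (IsCMField.complexConj L) N X))) :
    archStableCentralizerEquiv L hX hH hc h z =
      ⟨Φ (archStableCentralizerEquiv L hX hH₂ ((corresponds_archCongr_right_iff L T Φ hΦ a γ).1 hc) h z :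
          Subgroup.centralizer ({γ} : Set (arch (↥(maximalRealSubfield L)) L (IsCMField.complexConj L) N H₂))),
        (forall_archCongr_mem_centralizer_iff L Φ rfl _).2 (archStableCentralizerEquiv L hX hH₂ ((corresponds_archCongr_right_iff L T Φ hΦ a γ).1 hc) h z).2⟩ :=
  Subtype.ext (Subtype.ext (coe_archStableCentralizerEquiv_archCongr_right L hH hH₂ hX T Φ hΦ hc h z))

include hΦ in
/-- **(N-R), measures**: `SCE(a, Φ γ)_* μ = (Φ|_{Z(γ)})_* (SCE(a, γ)_* μ)`. [cite: Rogawski1990, §4.3 pp. 43–44; §14.1 p. 232] [cite: DeitmarEchterhoff2014, Thm. 1.5.3] -/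
theorem map_archStableCentralizerEquiv_archCongr_right_eq_map_subgroupCongrHomeomorph
    [MeasurableSpace (arch (↥(maximalRealSubfield L)) L (IsCMField.complexConj L) N H₂)] [BorelSpace (arch (↥(maximalRealSubfield L)) L (IsCMField.complexConj L) N H₂)]
    [MeasurableSpace (arch (↥(maximalRealSubfield L)) L (IsCMField.complexConj L) N H)] [BorelSpace (arch (↥(maximalRealSubfield L)) L (IsCMField.complexConj L) N H)]
    [MeasurableSpace (arch (↥(maximalRealSubfield L)) L (IsCMField.complexConj L) N X)] [BorelSpace (arch (↥(maximalRealSubfield L)) L (IsCMField.complexConj L) N X)]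
    {a : arch (↥(maximalRealSubfield L)) L (IsCMField.complexConj L) N X} {γ : arch (↥(maximalRealSubfield L)) L (IsCMField.complexConj L) N H₂}
    (hc : Corresponds (conjMixed (↥(maximalRealSubfield L)) L (IsCMField.complexConj L)) (archFormOf L N X) (archFormOf L N H) a (Φ γ))
    (h : IsRegularElt (a.val : GL (Fin N) (mixedEmbedding.mixedSpace L)))
    (μ : Measure (Subgroup.centralizer ({a} : Set (arch (↥(maximalRealSubfield L)) L (IsCMField.complexConj L) N X)))) :
    Measure.map (archStableCentralizerEquiv L hX hH hc h) μ =
      Measure.map (subgroupCongrHomeomorph Φ.toMulEquiv (Subgroup.centralizer ({γ} : Set _)) (Subgroup.centralizer ({Φ γ} : Set _))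
          (forall_archCongr_mem_centralizer_iff L Φ rfl) Φ.continuous Φ.symm.continuous)
        (Measure.map (archStableCentralizerEquiv L hX hH₂ ((corresponds_archCongr_right_iff L T Φ hΦ a γ).1 hc) h) μ) := by
  rw [Measure.map_map (Homeomorph.continuous _).measurable
    (map_continuous (archStableCentralizerEquiv L hX hH₂ ((corresponds_archCongr_right_iff L T Φ hΦ a γ).1 hc) h)).measurable]
  congr 1
  funext z
  rw [archStableCentralizerEquiv_archCongr_right_apply L hH hH₂ hX T Φ hΦ hc h z]
  rfl

/-! ### (N-B) BOTH: one group moved by `Φ` (the (C′)∕(C) shape) -/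

include hΦ in
/-- **(N-B), values**: for `γ₁ γ₂ ∈ U(H₂)` with `Φ γ₁ ↔ Φ γ₂` regular and `z ∈ Z(γ₁)`: `SCE(Φ γ₁, Φ γ₂)(Φ z) = Φ (SCE(γ₁, γ₂)(z))` (`T⁻¹·y·T` conjugates `γ₁` to `γ₂` when `y` conjugates
`Φ γ₁` to `Φ γ₂`). [cite: Rogawski1990, §4.3 pp. 43–44; §14.1 p. 232] [cite: PlatonovRapinchuk1994, §2.3] -/
theorem coe_archStableCentralizerEquiv_archCongr_both {γ₁ γ₂ : arch (↥(maximalRealSubfield L)) L (IsCMField.complexConj L) N H₂}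
    (hc : Corresponds (conjMixed (↥(maximalRealSubfield L)) L (IsCMField.complexConj L)) (archFormOf L N H) (archFormOf L N H) (Φ γ₁) (Φ γ₂))
    (h : IsRegularElt ((Φ γ₁).val : GL (Fin N) (mixedEmbedding.mixedSpace L)))
    (z : Subgroup.centralizer ({γ₁} : Set (arch (↥(maximalRealSubfield L)) L (IsCMField.complexConj L) N H₂))) :
    (((archStableCentralizerEquiv L hH hH hc h ⟨Φ z, (forall_archCongr_mem_centralizer_iff L Φ rfl z).2 z.2⟩ :
        Subgroup.centralizer ({Φ γ₂} : Set (arch (↥(maximalRealSubfield L)) L (IsCMField.complexConj L) N H))) :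
          arch (↥(maximalRealSubfield L)) L (IsCMField.complexConj L) N H).val : GL (Fin N) (mixedEmbedding.mixedSpace L)) =
      ((Φ ((archStableCentralizerEquiv L hH₂ hH₂
          ((corresponds_archCongr_right_iff L T Φ hΦ γ₁ γ₂).1 ((corresponds_archCongr_left_iff L T Φ hΦ γ₁ (Φ γ₂)).1 hc))
          ((isRegularElt_coe_archCongr_iff L T Φ hΦ γ₁).1 h) z :
        Subgroup.centralizer ({γ₂} : Set (arch (↥(maximalRealSubfield L)) L (IsCMField.complexConj L) N H₂))) :
          arch (↥(maximalRealSubfield L)) L (IsCMField.complexConj L) N H₂) : arch (↥(maximalRealSubfield L)) L (IsCMField.complexConj L) N H).val :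
            GL (Fin N) (mixedEmbedding.mixedSpace L)) := by
  rw [coe_archStableCentralizerEquiv_archCongr_left L hH hH₂ hH T Φ hΦ hc h z]
  exact coe_archStableCentralizerEquiv_archCongr_right L hH hH₂ hH₂ T Φ hΦ ((corresponds_archCongr_left_iff L T Φ hΦ γ₁ (Φ γ₂)).1 hc)
    ((isRegularElt_coe_archCongr_iff L T Φ hΦ γ₁).1 h) z

include hΦ in
/-- **(N-B), measures — the (C′)∕(C) shape under transport**: `SCE(Φ γ₁, Φ γ₂)_* ((Φ|_{Z(γ₁)})_* μ) = (Φ|_{Z(γ₂)})_* (SCE(γ₁, γ₂)_* μ)`.  So (C′) for `t′` at `(Φ γ₁, Φ γ₂)` with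
`t′(Φ γᵢ) = (Φ|_Z)_* t₂ γᵢ` IS (C′) for the transported `t₂` at `(γ₁, γ₂)` (cancel the homeomorphism `Φ|_{Z(γ₂)}`). [cite: Rogawski1990, §4.3 pp. 43–44; §14.1 p. 232] [cite: DeitmarEchterhoff2014, Thm. 1.5.3] -/
theorem map_archStableCentralizerEquiv_map_subgroupCongrHomeomorph_archCongr_both
    [MeasurableSpace (arch (↥(maximalRealSubfield L)) L (IsCMField.complexConj L) N H₂)] [BorelSpace (arch (↥(maximalRealSubfield L)) L (IsCMField.complexConj L) N H₂)]
    [MeasurableSpace (arch (↥(maximalRealSubfield L)) L (IsCMField.complexConj L) N H)] [BorelSpace (arch (↥(maximalRealSubfield L)) L (IsCMField.complexConj L) N H)]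
    {γ₁ γ₂ : arch (↥(maximalRealSubfield L)) L (IsCMField.complexConj L) N H₂}
    (hc : Corresponds (conjMixed (↥(maximalRealSubfield L)) L (IsCMField.complexConj L)) (archFormOf L N H) (archFormOf L N H) (Φ γ₁) (Φ γ₂))
    (h : IsRegularElt ((Φ γ₁).val : GL (Fin N) (mixedEmbedding.mixedSpace L)))
    (μ : Measure (Subgroup.centralizer ({γ₁} : Set (arch (↥(maximalRealSubfield L)) L (IsCMField.complexConj L) N H₂)))) :
    Measure.map (archStableCentralizerEquiv L hH hH hc h)
        (Measure.map (subgroupCongrHomeomorph Φ.toMulEquiv (Subgroup.centralizer ({γ₁} : Set _)) (Subgroup.centralizer ({Φ γ₁} : Set _))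
          (forall_archCongr_mem_centralizer_iff L Φ rfl) Φ.continuous Φ.symm.continuous) μ) =
      Measure.map (subgroupCongrHomeomorph Φ.toMulEquiv (Subgroup.centralizer ({γ₂} : Set _)) (Subgroup.centralizer ({Φ γ₂} : Set _))
          (forall_archCongr_mem_centralizer_iff L Φ rfl) Φ.continuous Φ.symm.continuous)
        (Measure.map (archStableCentralizerEquiv L hH₂ hH₂
          ((corresponds_archCongr_right_iff L T Φ hΦ γ₁ γ₂).1 ((corresponds_archCongr_left_iff L T Φ hΦ γ₁ (Φ γ₂)).1 hc))
          ((isRegularElt_coe_archCongr_iff L T Φ hΦ γ₁).1 h)) μ) := by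
  rw [Measure.map_map (map_continuous (archStableCentralizerEquiv L hH hH hc h)).measurable (Homeomorph.continuous _).measurable,
    Measure.map_map (Homeomorph.continuous _).measurable
      (map_continuous (archStableCentralizerEquiv L hH₂ hH₂
        ((corresponds_archCongr_right_iff L T Φ hΦ γ₁ γ₂).1 ((corresponds_archCongr_left_iff L T Φ hΦ γ₁ (Φ γ₂)).1 hc))
        ((isRegularElt_coe_archCongr_iff L T Φ hΦ γ₁).1 h))).measurable]
  congr 1
  funext z
  apply Subtype.ext
  apply Subtype.ext
  exact coe_archStableCentralizerEquiv_archCongr_both L hH hH₂ T Φ hΦ hc h z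

end Naturality

end UnitaryGroup

end Literature.NumberTheory.Automorphic

end
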